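import Summits.QuantumAdvantage.QuantumAdvantage.Theses.ExactnessDial
import Summits.QuantumAdvantage.QuantumAdvantage.Theorems.HolonomyDialLaws
import Summits.QuantumAdvantage.AdviceFreeQNC0.WalkCoordinates
import Summits.QuantumAdvantage.AdviceFreeQNC0.RingCanonical
import Summits.QuantumAdvantage.QuantumAdvantage.Theorems.HolonomyDialFlip

/-!
# AnchorDial — Pointer (cell decomp-qadv, seat lens-2, generation 14; supports item 26531 `ExactnessDial.PolyLossOddU3`)

§0–§2 of the node: objects (`flip2`, `outB`, `dev`, `cN`), the pieces **`MovingPointerLoss3`** (moving-anchor pointer law, crux) and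
**`PtrLocLift3`** (declared residual), the win dictionary `win_iff` (any strategy), the moving pointer strategy `mpStrat` with
`rel_mpStrat_iff`, NECESSITY `movingPointerLoss3_of_polyLossOddU3`, DOMINATION `binPointerLoss3_of_movingPointerLoss3`,
`node_iff`, and `closes : MovingPointerLoss3 → PtrLocLift3 → DPLift3 → AdviceFreeQNC0Three` (via the tree's `HolonomyDial.closes_T`).

Split (≤ 400 lines, part 2/3) of the node file `HOME/decomp-qadv-lens-2/g14/AnchorDial.lean` (sha256 a954f04b…, farm rc 0, no
placeholders); declarations verbatim, namespace `Summit.QuantumAdvantage.QuantumAdvantage.Theorems.AnchorDial`.  Record: NODE-g14.md.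
-/

set_option linter.dupNamespace false
set_option linter.unusedVariables false

/-! ## §0 Objects -/

noncomputable section

open scoped Classical

namespace Summit.QuantumAdvantage.QuantumAdvantage.Theorems.AnchorDial

open Finset
open Literature.Computability.QuantumComplexity Literature.Computability.QuantumComplexity.RingHLF
open Literature.Computability.MetaComplexity Literature.Computability.MetaComplexity.Smolensky
open Summit.QuantumAdvantage.AdviceFreeQNC0
open Summit.QuantumAdvantage.QuantumAdvantage.Theses (ExactnessDial.PolyLossOddU3 ExactnessDial.DPLift3)
-- only the tree gadgets we use (the g13 package keeps landing under `Theorems.HolonomyDial`; no blanket `open`)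
open Summit.QuantumAdvantage.QuantumAdvantage.Theorems.HolonomyDial (gCond selP selP_mem selP_apply xorP xorP_mem
  xorP_apply_bool tPoly tPoly_mem tPoly_apply BinPtrWin BinPointerLoss3 HolDecodeLoss3 holDecodeLoss3_of_binPointerLoss3
  closes_T)

variable {N : ℕ}

/-- flip the two bits at positions `a, b` (vendored from g13 §S). -/
def flip2 (a b : ℕ) (x : Fin N → Bool) : Fin N → Bool := fun j => if j.val = a ∨ j.val = b then !x j else x j

/-- AnchorDialPointer helper `flip2_flip2` (decomp-qadv land package; see the module docstring). -/
theorem flip2_flip2 (a b : ℕ) (x : Fin N → Bool) : flip2 a b (flip2 a b x) = x := by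
  funext j
  simp only [flip2]
  split_ifs <;> simp

/-- AnchorDialPointer helper `flip2_apply_of_ne` (decomp-qadv land package; see the module docstring). -/
theorem flip2_apply_of_ne {a b : ℕ} (x : Fin N → Bool) {j : Fin N} (ha : j.val ≠ a) (hb : j.val ≠ b) :
    flip2 a b x j = x j := by
  simp only [flip2, ha, hb, or_self, if_false]

/-- prefix zero-parities of a double flip: flipped exactly on `(a, b]`. -/
theorem zpar_flip2 {a b : ℕ} (hab : a < b) (x : Fin N → Bool) :
    ∀ k, k ≤ N → zpar (flip2 a b x) k = if a < k ∧ k ≤ b then !zpar x k else zpar x k := by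
  intro k hk
  induction k with
  | zero => rw [zpar_zero, zpar_zero, if_neg (by omega)]
  | succ k ih =>
    have hkN : k < N := by omega
    rw [zpar_succ _ hkN, zpar_succ _ hkN, ih (by omega)]
    simp only [flip2]
    generalize zpar x k = p
    generalize x ⟨k, hkN⟩ = q
    split_ifs <;> first | omega | (cases p <;> cases q <;> rfl)

/-- AnchorDialPointer helper `oddZeros_flip2` (decomp-qadv land package; see the module docstring). -/
theorem oddZeros_flip2 {a b : ℕ} (hab : a < b) (hbN : b < N) (x : Fin N → Bool) :
    OddZeros (flip2 a b x) ↔ OddZeros x := by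
  rw [HolonomyDial.oddZeros_iff_zpar, HolonomyDial.oddZeros_iff_zpar, zpar_flip2 hab x N le_rfl, if_neg (show ¬ (a < N ∧ N ≤ b) by omega)]

/-- the odd class is permuted by a double flip (counting version). -/
theorem card_filter_flip2 {a b : ℕ} (hab : a < b) (hbN : b < N) (Q : (Fin N → Bool) → Prop) [DecidablePred Q] :
    (univ.filter fun x : Fin N → Bool => OddZeros x ∧ Q (flip2 a b x)).card =
      (univ.filter fun x : Fin N → Bool => OddZeros x ∧ Q x).card := by
  refine Finset.card_bij (fun x _ => flip2 a b x) (fun x hx => ?_) (fun x₁ _ x₂ _ h => ?_) (fun y hy => ?_)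
  · rw [mem_filter] at hx ⊢
    exact ⟨mem_univ _, (oddZeros_flip2 hab hbN x).2 hx.2.1, hx.2.2⟩
  · have h' := congrArg (flip2 a b) h
    simpa only [flip2_flip2] using h'
  · refine ⟨flip2 a b y, ?_, flip2_flip2 a b y⟩
    rw [mem_filter] at hy ⊢
    refine ⟨mem_univ _, (oddZeros_flip2 hab hbN _).2 hy.2.1, ?_⟩
    rw [flip2_flip2]; exact hy.2.2

/-- the strategy's output bits `z_i = [P_i(x) = 1]`. -/
def outB (P : Fin N → CubeFn (ZMod 3) N) (x : Fin N → Bool) : Fin N → Bool := fun i => decide (P i x = 1)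

/-- the DEVIATION SET of the strategy at `x`: positions where it departs from the canonical guess `t(x)`. -/
def dev (P : Fin N → CubeFn (ZMod 3) N) (x : Fin N → Bool) : Finset (Fin N) :=
  univ.filter fun i => decide (P i x = 1) ≠ tGuess x i

/-- the unreduced kernel phase at position `k`: `c_k(x) = k + N + W_k(x) + W(x)`; the kernel bit is
`g_k(x) = [c_k(x) ≢ 2 (mod 3)]` (tree `traceForm`; `gCond x k ↔ cN x k % 3 ≠ 2` is `Iff.rfl`). -/
def cN (x : Fin N → Bool) (k : ℕ) : ℕ := k + N + Wk x k + Wk x (N - 1)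

/-- AnchorDialPointer helper `gCond_iff_cN` (decomp-qadv land package; see the module docstring). -/
theorem gCond_iff_cN (x : Fin N → Bool) (k : ℕ) : gCond x k ↔ cN x k % 3 ≠ 2 := Iff.rfl

/-! ## §1 Pieces -/

/-- **PIECE (crux) `MovingPointerLoss3` — the MOVING-ANCHOR pointer law.**  A *pointer certificate* of degree
`(log₂ n)^c` is a family of anchor indicators `A_k` and selectors `f_k` (`k < n`, all of `𝔽₃`-degree
`≤ (log₂ n)^c`); it DECLARES the anchor `k` at `x` when `A_k(x) = 1`, and its pointer is the position
`k + [f_k(x) ≠ 1]` (cyclically); it is CERTIFIED-WINNING at `x` when exactly one anchor is declared and the kernel bit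
at the pointer is `1` (`gCond`).  Hypotheses (measure-robust, constants immaterial): (UNIQ) all but a `2^{-12}`
fraction of the odd class declares exactly one anchor; (STAB) under an average adjacent pair-flip `(a, a+1)` the
declared anchors change on at most a `2^{-12}` fraction.  Conclusion: the certified-winning part of the odd class has
measure `≤ 1 - n^{-C}`.  NECESSARY for `T` (PROVED); dominates g13's `BinPointerLoss3` (PROVED: `A_k = [k = 0]`). -/
def MovingPointerLoss3 : Prop :=
  ∃ C : ℕ, ∀ c : ℕ, ∃ n₀ : ℕ, ∀ n ≥ n₀, ∀ A f : Fin n → CubeFn (ZMod 3) n,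
    (∀ k, A k ∈ lowDeg (ZMod 3) n ((Nat.log 2 n) ^ c)) → (∀ k, f k ∈ lowDeg (ZMod 3) n ((Nat.log 2 n) ^ c)) →
    4096 * (univ.filter fun x : Fin n → Bool =>
        OddZeros x ∧ (univ.filter fun k : Fin n => A k x = 1).card ≠ 1).card ≤ 2 ^ (n - 1) →
    4096 * (∑ a ∈ range n, (univ.filter fun x : Fin n → Bool =>
        OddZeros x ∧ ∃ k : Fin n, ¬ ((A k (flip2 a (a + 1) x) = 1) ↔ (A k x = 1))).card) ≤ n * 2 ^ (n - 1) →
      ((univ.filter fun x : Fin n → Bool => OddZeros x ∧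
          ∃ k : Fin n, (univ.filter fun k' : Fin n => A k' x = 1) = {k} ∧
            gCond x ((k.val + (if f k x = 1 then 0 else 1)) % n)).card : ℝ) ≤
        (1 - 1 / (n : ℝ) ^ C) * (2 : ℝ) ^ (n - 1)

/-- **PIECE (declared residual) `PtrLocLift3`** — LOCALISATION: the moving-anchor pointer law lifts to every
polylog-degree strategy («a near-perfect strategy's wins are explained by a pointer certificate»).  `≡ T` modulo
`MovingPointerLoss3`; IDEA-NEEDED. -/
def PtrLocLift3 : Prop := MovingPointerLoss3 → ExactnessDial.PolyLossOddU3

/-! ## §2 Laws: the certified pointer is a strategy (necessity), the constant anchor is g13's rung (domination),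
node equation, `closes` -/

section Strategy

/-- **win characterisation of an arbitrary strategy** (tree `traceForm`): on the odd class the strategy wins iff an
ODD number of its deviations sit on kernel positions. -/
theorem win_iff (hN : 3 ≤ N) (P : Fin N → CubeFn (ZMod 3) N) (x : Fin N → Bool) (hx : OddZeros x) :
    Rel x (outB P x) ↔ ((dev P x).filter fun k => gCond x k.val).card % 2 = 1 := by
  rw [traceForm hN x hx (outB P x)]
  have e : (univ.filter fun k : Fin N => xor (outB P x k) (tGuess x k) = true ∧
        (k.val + N + Wk x k.val + Wk x (N - 1)) % 3 ≠ 2) = (dev P x).filter fun k => gCond x k.val := by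
    ext k
    simp only [dev, outB, gCond, mem_filter, mem_univ, true_and]
    generalize decide (P k x = 1) = p
    generalize tGuess x k = q
    cases p <;> cases q <;> simp
  rw [e]

/-- deviation indicator of the certified pointer at position `i`: `Σ_k [A_k = 1]·[pointer(k) = i]`. -/
def devInd (A f : Fin N → CubeFn (ZMod 3) N) (i : Fin N) : CubeFn (ZMod 3) N :=
  ∑ k : Fin N, selP (A k) *
    ((if k = i then selP (f k) else 0) + (if (k.val + 1) % N = i.val then 1 - selP (f k) else 0))

/-- **the moving pointer strategy** of a certificate: canonical guess, toggled at the declared pointer. -/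
def mpStrat (A f : Fin N → CubeFn (ZMod 3) N) (i : Fin N) : CubeFn (ZMod 3) N := xorP (tPoly i) (devInd A f i)

/-- AnchorDialPointer helper `devInd_mem` (decomp-qadv land package; see the module docstring). -/
theorem devInd_mem {D : ℕ} {A f : Fin N → CubeFn (ZMod 3) N} (hA : ∀ k, A k ∈ lowDeg (ZMod 3) N D)
    (hf : ∀ k, f k ∈ lowDeg (ZMod 3) N D) (i : Fin N) :
    devInd A f i ∈ lowDeg (ZMod 3) N ((D + D) + (D + D)) := by
  unfold devInd
  refine Submodule.sum_mem _ fun k _ => mul_mem_lowDeg_add (selP_mem (hA k)) (Submodule.add_mem _ ?_ ?_)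
  · split_ifs
    · exact selP_mem (hf k)
    · exact Submodule.zero_mem _
  · split_ifs
    · exact Submodule.sub_mem _ (one_mem_lowDeg _) (selP_mem (hf k))
    · exact Submodule.zero_mem _

/-- AnchorDialPointer helper `mpStrat_mem` (decomp-qadv land package; see the module docstring). -/
theorem mpStrat_mem {D : ℕ} {A f : Fin N → CubeFn (ZMod 3) N} (hA : ∀ k, A k ∈ lowDeg (ZMod 3) N D)
    (hf : ∀ k, f k ∈ lowDeg (ZMod 3) N D) (i : Fin N) :
    mpStrat A f i ∈ lowDeg (ZMod 3) N (2 + ((D + D) + (D + D))) :=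
  xorP_mem (tPoly_mem i) (devInd_mem hA hf i)

/-- on a uniquely anchored input the deviation indicator is the indicator of the pointer. -/
theorem devInd_apply (A f : Fin N → CubeFn (ZMod 3) N) (x : Fin N → Bool) (k₀ : Fin N)
    (huniq : (univ.filter fun k' : Fin N => A k' x = 1) = {k₀}) (i : Fin N) :
    devInd A f i x = if i.val = (k₀.val + (if f k₀ x = 1 then 0 else 1)) % N then 1 else 0 := by
  have hk₀ : A k₀ x = 1 := by
    have h := mem_singleton_self k₀
    rw [← huniq, mem_filter] at h
    exact h.2
  have hne : ∀ k, k ≠ k₀ → A k x ≠ 1 := by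
    intro k hk h
    have h' : k ∈ univ.filter fun k' : Fin N => A k' x = 1 := mem_filter.2 ⟨mem_univ _, h⟩
    rw [huniq, mem_singleton] at h'
    exact hk h'
  unfold devInd
  rw [Finset.sum_apply, Finset.sum_eq_single k₀]
  · simp only [Pi.mul_apply, Pi.add_apply, selP_apply, hk₀, if_true, one_mul, ite_apply, Pi.zero_apply,
      Pi.sub_apply, Pi.one_apply]
    by_cases hf : f k₀ x = 1
    · simp only [hf, if_true, sub_self, ite_self, add_zero, Nat.mod_eq_of_lt k₀.isLt]
      by_cases hki : k₀ = i
      · subst hki; simp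
      · rw [if_neg hki, if_neg (fun h => hki (Fin.ext h.symm))]
    · simp only [hf, if_false, sub_zero, ite_self, zero_add]
      by_cases hk1 : (k₀.val + 1) % N = i.val
      · rw [if_pos hk1, if_pos hk1.symm]
      · rw [if_neg hk1, if_neg (fun h => hk1 h.symm)]
  · intro k _ hk
    simp only [Pi.mul_apply, selP_apply, if_neg (hne k hk), zero_mul]
  · intro h; exact absurd (mem_univ _) h

/-- **LAW (moving pointer dictionary)**: on a uniquely anchored odd input the moving pointer strategy satisfies the
ring relation iff the kernel bit at the declared pointer is `1`. -/
theorem rel_mpStrat_iff (hN : 3 ≤ N) (A f : Fin N → CubeFn (ZMod 3) N) (x : Fin N → Bool) (hx : OddZeros x)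
    (k₀ : Fin N) (huniq : (univ.filter fun k' : Fin N => A k' x = 1) = {k₀}) :
    Rel x (outB (mpStrat A f) x) ↔ gCond x ((k₀.val + (if f k₀ x = 1 then 0 else 1)) % N) := by
  rw [win_iff hN _ x hx]
  set p := (k₀.val + (if f k₀ x = 1 then 0 else 1)) % N with hp
  have hpN : p < N := Nat.mod_lt _ (by omega)
  have hdev : dev (mpStrat A f) x = {⟨p, hpN⟩} := by
    ext i
    simp only [dev, mem_filter, mem_univ, true_and, mem_singleton]
    have hout : decide (mpStrat A f i x = 1) = xor (tGuess x i) (decide (i.val = p)) := by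
      have hq : devInd A f i x = if decide (i.val = p) then 1 else 0 := by
        rw [devInd_apply A f x k₀ huniq i, ← hp]
        by_cases h : i.val = p <;> simp [h]
      have h := xorP_apply_bool (tPoly i) (devInd A f i) x (tGuess x i) (decide (i.val = p)) (tPoly_apply i x) hq
      show decide (xorP (tPoly i) (devInd A f i) x = 1) = _
      rw [h]
      cases xor (tGuess x i) (decide (i.val = p)) <;> decide
    rw [hout, Fin.ext_iff]
    show _ ↔ i.val = p
    cases tGuess x i <;> by_cases h : i.val = p <;> simp [h]
  rw [hdev, Finset.filter_singleton]
  by_cases hg : gCond x p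
  · rw [if_pos hg, card_singleton]; simp [hg]
  · rw [if_neg hg, card_empty]; simp [hg]

end Strategy

/-- degree bookkeeping: `2 + 4·(log₂ n)^c ≤ (log₂ n)^(c+1)` once `n ≥ 64`. -/
theorem deg_bump4 (n c : ℕ) (hn : 64 ≤ n) :
    2 + (((Nat.log 2 n) ^ c + (Nat.log 2 n) ^ c) + ((Nat.log 2 n) ^ c + (Nat.log 2 n) ^ c)) ≤
      (Nat.log 2 n) ^ (c + 1) := by
  have hL : 6 ≤ Nat.log 2 n := by
    rw [show (64 : ℕ) = 2 ^ 6 by norm_num] at hn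
    exact Nat.le_log_of_pow_le (by norm_num) hn
  have hpos : 1 ≤ (Nat.log 2 n) ^ c := Nat.one_le_pow _ _ (by omega)
  rw [pow_succ]
  nlinarith

/-- **NECESSITY of the crux**: `PolyLossOddU3 → MovingPointerLoss3` — the certified pointer IS a polylog-degree
strategy (`mpStrat`, degree `2 + 4(log n)^c ≤ (log n)^{c+1}`), winning wherever the certificate is
certified-winning (`rel_mpStrat_iff`); the a.e. hypotheses are not even used. -/
theorem movingPointerLoss3_of_polyLossOddU3 (h : ExactnessDial.PolyLossOddU3) : MovingPointerLoss3 := by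
  obtain ⟨C, hC⟩ := h
  refine ⟨C, fun c => ?_⟩
  obtain ⟨n₀, hn₀⟩ := hC (c + 1)
  refine ⟨max n₀ 64, fun n hn A f hA hf _ _ => ?_⟩
  have hn64 : 64 ≤ n := le_of_max_le_right hn
  have hP : ∀ i, mpStrat A f i ∈ lowDeg (ZMod 3) n ((Nat.log 2 n) ^ (c + 1)) := fun i =>
    lowDeg_mono (deg_bump4 n c hn64) (mpStrat_mem hA hf i)
  have hle := hn₀ n (le_of_max_le_left hn) (mpStrat A f) hP
  refine le_trans ?_ hle
  have hsub : (univ.filter fun x : Fin n → Bool => OddZeros x ∧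
        ∃ k : Fin n, (univ.filter fun k' : Fin n => A k' x = 1) = {k} ∧
          gCond x ((k.val + (if f k x = 1 then 0 else 1)) % n)) ⊆
      univ.filter fun x : Fin n → Bool => OddZeros x ∧ Rel x (fun i => decide (mpStrat A f i x = 1)) := by
    intro x hx
    rw [mem_filter] at hx ⊢
    obtain ⟨-, hodd, k, hk, hg⟩ := hx
    exact ⟨mem_univ _, hodd, (rel_mpStrat_iff (by omega) A f x hodd k hk).2 hg⟩
  exact_mod_cast card_le_card hsub

/-- **DOMINATION of g13's proved rung**: `MovingPointerLoss3 → BinPointerLoss3` (the constant anchor `A_k = [k = 0]`: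
uniquely declared everywhere, perfectly stable; its pointer is g13's {0,1}-pointer). -/
theorem binPointerLoss3_of_movingPointerLoss3 (h : MovingPointerLoss3) : BinPointerLoss3 := by
  obtain ⟨C, hC⟩ := h
  refine ⟨C, fun c => ?_⟩
  obtain ⟨n₀, hn₀⟩ := hC c
  refine ⟨max n₀ 2, fun n hn f hf => ?_⟩
  have hn2 : 2 ≤ n := le_of_max_le_right hn
  set A : Fin n → CubeFn (ZMod 3) n := fun k => if k.val = 0 then 1 else 0 with hAdef
  have hA : ∀ k, A k ∈ lowDeg (ZMod 3) n ((Nat.log 2 n) ^ c) := by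
    intro k
    simp only [hAdef]
    split_ifs
    · exact one_mem_lowDeg _
    · exact Submodule.zero_mem _
  have hAx : ∀ (k : Fin n) (y : Fin n → Bool), (A k y = 1) ↔ k.val = 0 := by
    intro k y
    simp only [hAdef]
    split_ifs with h
    · simp [h]
    · simp [h]
  set z0 : Fin n := ⟨0, by omega⟩ with hz0
  have hfilt : ∀ y : Fin n → Bool, (univ.filter fun k' : Fin n => A k' y = 1) = {z0} := by
    intro y
    ext k
    rw [mem_filter, mem_singleton, hAx, Fin.ext_iff]
    simp [hz0]
  have hU : 4096 * (univ.filter fun x : Fin n → Bool =>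
      OddZeros x ∧ (univ.filter fun k : Fin n => A k x = 1).card ≠ 1).card ≤ 2 ^ (n - 1) := by
    have e : (univ.filter fun x : Fin n → Bool =>
        OddZeros x ∧ (univ.filter fun k : Fin n => A k x = 1).card ≠ 1) = ∅ := by
      rw [Finset.filter_eq_empty_iff]
      rintro x - ⟨-, h⟩
      rw [hfilt x, card_singleton] at h
      exact h rfl
    rw [e, card_empty, mul_zero]
    exact Nat.zero_le _
  have hS : 4096 * (∑ a ∈ range n, (univ.filter fun x : Fin n → Bool =>
      OddZeros x ∧ ∃ k : Fin n, ¬ ((A k (flip2 a (a + 1) x) = 1) ↔ (A k x = 1))).card) ≤ n * 2 ^ (n - 1) := by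
    have e : ∀ a, (univ.filter fun x : Fin n → Bool =>
        OddZeros x ∧ ∃ k : Fin n, ¬ ((A k (flip2 a (a + 1) x) = 1) ↔ (A k x = 1))) = ∅ := by
      intro a
      rw [Finset.filter_eq_empty_iff]
      rintro x - ⟨-, k, hk⟩
      exact hk (by rw [hAx, hAx])
    simp_rw [e, card_empty, sum_const_zero, mul_zero]
    exact Nat.zero_le _
  have h1 := hn₀ n (le_of_max_le_left hn) A (fun _ => f) hA (fun _ => hf) hU hS
  have hset : (univ.filter fun x : Fin n → Bool => OddZeros x ∧ BinPtrWin f x) =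
      univ.filter fun x : Fin n → Bool => OddZeros x ∧
        ∃ k : Fin n, (univ.filter fun k' : Fin n => A k' x = 1) = {k} ∧
          gCond x ((k.val + (if f x = 1 then 0 else 1)) % n) := by
    refine filter_congr fun x _ => ?_
    have hptr : BinPtrWin f x ↔ gCond x ((z0.val + (if f x = 1 then 0 else 1)) % n) := by
      unfold BinPtrWin
      by_cases hf1 : f x = 1
      · rw [if_pos hf1, hz0]
        simp only [Nat.add_zero, Nat.zero_mod]
        exact ⟨fun h => h.1 hf1, fun h => ⟨fun _ => h, fun h' => absurd hf1 h'⟩⟩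
      · rw [if_neg hf1, hz0]
        simp only [Nat.zero_add, Nat.mod_eq_of_lt (show 1 < n by omega)]
        exact ⟨fun h => h.2 hf1, fun h => ⟨fun h' => absurd h' hf1, fun _ => h⟩⟩
    rw [hptr]
    refine and_congr_right fun _ => ⟨fun h => ⟨z0, hfilt x, h⟩, ?_⟩
    rintro ⟨k, hk, hg⟩
    rw [hfilt x, Finset.singleton_inj] at hk
    rw [hk]; exact hg
  rw [hset]
  exact h1

/-! ### Node equation and `closes` -/

/-- EXHAUSTION: the node equation `T ⟺ MovingPointerLoss3 ∧ PtrLocLift3` (kernel identity given necessity). -/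
theorem node_iff : ExactnessDial.PolyLossOddU3 ↔ MovingPointerLoss3 ∧ PtrLocLift3 :=
  ⟨fun h => ⟨movingPointerLoss3_of_polyLossOddU3 h, fun _ => h⟩, fun h => h.2 h.1⟩

/-- the chain below the crux: the moving-anchor law gives g13's pointer rung and hence its decode rung (tree). -/
theorem holDecodeLoss3_of_movingPointerLoss3 (h : MovingPointerLoss3) : HolDecodeLoss3 :=
  holDecodeLoss3_of_binPointerLoss3 (binPointerLoss3_of_movingPointerLoss3 h)

/-- **`closes`** — the node decides the rung leaf BY NAME: crux + declared residual give the junction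
`PolyLossOddU3`, and the tree's `Theorems.HolonomyDial.closes_T` carries it through the cone (`ExactnessDial.closes`,
the landed `OddToAll3` / `MultiRingBridge3`, the cone's residual `DPLift3` as hypothesis, exactly as in g12/g13). -/
theorem closes (hM : MovingPointerLoss3) (hL : PtrLocLift3) (hD : ExactnessDial.DPLift3) :
    Summit.QuantumAdvantage.AdviceFreeQNC0.AdviceFreeQNC0Three :=
  closes_T (hL hM) hD

end Summit.QuantumAdvantage.QuantumAdvantage.Theorems.AnchorDial

end
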